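import Summits.AtomisticToContinuum.Crystallization.Theorems.ChargedEnergyGapBulkCarrier
import Summits.AtomisticToContinuum.Crystallization.Theorems.ChargedEnergyGapCarrierCount
import HarnessLib

/-!
# Charged energy gap — lens-3 g63, part P-Z₅b: PASSAGE POINTS — distinct shell sites along the segment of a bulk–far pair, at prescribed levels

Cell `decomp-a2c`, seat lens-3, generation 63, part P-Z₅b (after P-Z₄ `ChargedEnergyGapBulkCarrier`, P-Z₄b `ChargedEnergyGapCarrierCount` and
P-Z₁ `ChargedEnergyGapLabelledCovering`).  ELEMENTARY·PROVED.  The fair-share attribution of the bulk far residue (HANDOFF §J (J4), scheme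
«16 passage blocks × cluster») spreads the load of a pair `(y, z)` — `y` a bulk source (`d(y, C) ≥ ϱ`), `z` a far excised site with
`d(z, C)` small — over sites near the points where its segment crosses the LEVELS `d(·, C) = L₀ + (44/10)·j` of the profile shell.  Since
`q ↦ d(q, C) = Metric.infDist q C` is `1`-Lipschitz (`Metric.infDist_le_infDist_add_dist`) and continuous, the segment `t ↦ y + t•(z − y)` meets
every level between `d(z, C)` and `d(y, C)` (intermediate value theorem), two points at levels `44/10` apart are at distance `≥ 44/10 > 438/100`,
and P-Z₁'s covering (a site within `219/100` of every point) makes the chosen sites pairwise distinct (P-Z₄b `injective_of_far_centres`):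
* `abs_infDist_sub_infDist_le` — `|d(p, C) − d(q, C)| ≤ dist p q`;
* ★ `exists_segment_point_infDist_eq` — for `d(z, C) ≤ L ≤ d(y, C)` a point `y + t•(z − y)`, `t ∈ [0, 1]`, at level exactly `L`;
* ★★ `exists_distinct_sites_at_levels` — on a `(lam ≤ 1/3, ℓ ≥ 3)`-labelled reference, for levels `L₀ + (44/10)·j` (`j < k`) between `d(z, C)`
  and `d(y, C)`: `k` pairwise DISTINCT sites `c j`, each within `219/100` of a point of the segment at level `L₀ + (44/10)·j`;
* ★ `profileWeight_pos_lt_one_near_level` — a site within `219/100` of a point at level `L ∈ (ϱ/2 + 219/100, ϱ − 219/100)` has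
  `0 < w_C < 1` (P-Z₄ `profileWeight_pos_of_lt_infDist` / `profileWeight_lt_one_of_infDist_lt`): the passage sites are SHELL sites — shell or
  transition carriers when non-excised, (H)-candidates when excised;
* ★ `exists_sixteen_shell_sites_record` — at `ϱ = 160`: a pair with `d(z, C) ≤ 84` and `150 ≤ d(y, C)` has `16` distinct sites `c j`
  (`j < 16`), `c j` within `219/100` of a segment point at level `84 + (44/10)·j`, all with `0 < w_C(c j) < 1`.
No separation, force or stress hypothesis is used; `C` is any set with `C.Nonempty` not even required (levels are values of `infDist`).
-/

noncomputable section

open scoped Classical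

open Literature.MathematicalPhysics.StatisticalMechanics Literature.Geometry.DiscreteGeometry
open Summit.AtomisticToContinuum.Crystallization.Theses.PricedLinkCensus
open Summit.AtomisticToContinuum.Crystallization.Theorems.ChargedEnergyGapNegative

namespace Summit.AtomisticToContinuum.Crystallization.Theorems.ChargedEnergyGapChartDial

section Levels

variable {C : Set E3}

/-- The level function `d(·, C)` is `1`-Lipschitz: `|d(p, C) − d(q, C)| ≤ dist p q`. [formal bookkeeping] -/
theorem abs_infDist_sub_infDist_le (p q : E3) : |Metric.infDist p C - Metric.infDist q C| ≤ dist p q := by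
  rw [abs_sub_le_iff]
  constructor
  · linarith [Metric.infDist_le_infDist_add_dist (s := C) (x := p) (y := q)]
  · linarith [Metric.infDist_le_infDist_add_dist (s := C) (x := q) (y := p), dist_comm p q]

/-- Points at levels at least `δ` apart are at distance at least `δ`. -/
theorem le_dist_of_infDist_add_le {p q : E3} {δ : ℝ} (h : Metric.infDist p C + δ ≤ Metric.infDist q C) : δ ≤ dist p q := by
  have h1 := abs_infDist_sub_infDist_le (C := C) q p
  rw [abs_le, dist_comm] at h1
  linarith [h1.2]

/-- ★ **EVERY LEVEL IS MET**: for `d(z, C) ≤ L ≤ d(y, C)` the segment from `y` to `z` has a point `y + t•(z − y)` (`0 ≤ t ≤ 1`) with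
`d(y + t•(z − y), C) = L` (intermediate value theorem for the continuous level function along the segment). -/
theorem exists_segment_point_infDist_eq {y z : E3} {L : ℝ} (hz : Metric.infDist z C ≤ L) (hy : L ≤ Metric.infDist y C) :
    ∃ t : ℝ, 0 ≤ t ∧ t ≤ 1 ∧ Metric.infDist (y + t • (z - y)) C = L := by
  set f : ℝ → ℝ := fun t => Metric.infDist (y + t • (z - y)) C with hf
  have hcont : Continuous f := (Metric.continuous_infDist_pt C).comp (continuous_const.add (continuous_id.smul continuous_const))
  have h0 : f 0 = Metric.infDist y C := by simp [hf]
  have h1 : f 1 = Metric.infDist z C := by simp [hf]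
  have hmem : L ∈ Set.Icc (f 1) (f 0) := ⟨by rw [h1]; exact hz, by rw [h0]; exact hy⟩
  obtain ⟨t, ht, htL⟩ := intermediate_value_Icc' (zero_le_one' ℝ) hcont.continuousOn hmem
  exact ⟨t, ht.1, ht.2, htL⟩

end Levels

section Passage

variable {lam ℓ : ℝ} {P : PeriodicConfiguration 3} {C : Set E3}

/-- ★★ **`k` DISTINCT SITES AT PRESCRIBED LEVELS ALONG A SEGMENT**: on a `(lam ≤ 1/3, ℓ ≥ 3)`-labelled reference, if the levels
`L₀ + (44/10)·j` (`j < k`) all lie between `d(z, C)` and `d(y, C)`, there are `k` pairwise distinct sites `c j`, the `j`-th within `219/100` of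
a point `y + t•(z − y)` (`0 ≤ t ≤ 1`) of the segment at level exactly `L₀ + (44/10)·j`. -/
theorem exists_distinct_sites_at_levels (hL : IsLabelledRef lam ℓ P) (hlam : lam ≤ 1 / 3) (hℓ : 3 ≤ ℓ) {y z : E3} {L₀ : ℝ} (k : ℕ)
    (hz : Metric.infDist z C ≤ L₀) (hy : ∀ j : Fin k, L₀ + 44 / 10 * (j : ℕ) ≤ Metric.infDist y C) :
    ∃ c : Fin k → E3, Function.Injective c ∧ ∀ j, c j ∈ P.points ∧ ∃ t : ℝ, 0 ≤ t ∧ t ≤ 1 ∧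
      Metric.infDist (y + t • (z - y)) C = L₀ + 44 / 10 * (j : ℕ) ∧ dist (y + t • (z - y)) (c j) ≤ 219 / 100 := by
  choose f hf using fun w : E3 => hL.exists_dist_le hlam hℓ w
  have hlev : ∀ j : Fin k, ∃ t : ℝ, 0 ≤ t ∧ t ≤ 1 ∧ Metric.infDist (y + t • (z - y)) C = L₀ + 44 / 10 * (j : ℕ) := fun j =>
    exists_segment_point_infDist_eq (by have h0 : (0 : ℝ) ≤ ((j : ℕ) : ℝ) := Nat.cast_nonneg _; linarith) (hy j)
  choose t ht0 ht1 htL using hlev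
  refine ⟨fun j => f (y + t j • (z - y)), ?_, fun j => ⟨(hf _).1, t j, ht0 j, ht1 j, htL j, (hf _).2⟩⟩
  refine injective_of_far_centres (x := fun j : Fin k => y + t j • (z - y)) (fun i j hij => ?_) fun j => (hf _).2
  rcases Nat.lt_or_gt_of_ne (fun h : (i : ℕ) = j => hij (Fin.ext h)) with h | h
  · have hij' : ((i : ℕ) : ℝ) + 1 ≤ (j : ℕ) := by exact_mod_cast h
    have hle : Metric.infDist (y + t i • (z - y)) C + 44 / 10 ≤ Metric.infDist (y + t j • (z - y)) C := by
      rw [htL i, htL j]; linarith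
    linarith [le_dist_of_infDist_add_le hle]
  · have hij' : ((j : ℕ) : ℝ) + 1 ≤ (i : ℕ) := by exact_mod_cast h
    have hle : Metric.infDist (y + t j • (z - y)) C + 44 / 10 ≤ Metric.infDist (y + t i • (z - y)) C := by
      rw [htL i, htL j]; linarith
    have := le_dist_of_infDist_add_le hle
    rw [dist_comm] at this
    linarith

variable {ϱ : ℝ}

/-- ★ **PASSAGE SITES ARE SHELL SITES**: a point `c` within `219/100` of a point `q` at a level `L` with `ϱ/2 + 219/100 < L < ϱ − 219/100` has
`0 < w_C(c) < 1` (`ϱ > 0`). -/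
theorem profileWeight_pos_lt_one_near_level (hϱ : 0 < ϱ) {q c : E3} {L : ℝ} (hq : Metric.infDist q C = L) (hlo : ϱ / 2 + 219 / 100 < L)
    (hhi : L < ϱ - 219 / 100) (hd : dist q c ≤ 219 / 100) : 0 < profileWeight ϱ C c ∧ profileWeight ϱ C c < 1 := by
  have h1 := abs_infDist_sub_infDist_le (C := C) q c
  rw [abs_le, hq] at h1
  exact ⟨profileWeight_pos_of_lt_infDist hϱ (by linarith [h1.1]), profileWeight_lt_one_of_infDist_lt hϱ (by linarith [h1.2])⟩

/-- ★ **THE RECORD PASSAGE** (`ϱ = 160`, shell `80 < d < 160`): a pair with `d(z, C) ≤ 84` and `150 ≤ d(y, C)` (every bulk source has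
`d(y, C) ≥ 160`) has `16` pairwise distinct sites, the `j`-th within `219/100` of a segment point at level `84 + (44/10)·j ∈ [84, 150]`, all of
profile weight strictly between `0` and `1` — shell or transition carriers when non-excised, (H)-candidates when excised. -/
theorem exists_sixteen_shell_sites_record (hL : IsLabelledRef lam ℓ P) (hlam : lam ≤ 1 / 3) (hℓ : 3 ≤ ℓ) {y z : E3}
    (hz : Metric.infDist z C ≤ 84) (hy : 150 ≤ Metric.infDist y C) :
    ∃ c : Fin 16 → E3, Function.Injective c ∧ ∀ j, c j ∈ P.points ∧ 0 < profileWeight 160 C (c j) ∧ profileWeight 160 C (c j) < 1 ∧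
      ∃ t : ℝ, 0 ≤ t ∧ t ≤ 1 ∧ Metric.infDist (y + t • (z - y)) C = 84 + 44 / 10 * (j : ℕ) ∧ dist (y + t • (z - y)) (c j) ≤ 219 / 100 := by
  have hyj : ∀ j : Fin 16, (84 : ℝ) + 44 / 10 * (j : ℕ) ≤ Metric.infDist y C := fun j => by
    have : ((j : ℕ) : ℝ) ≤ 15 := by exact_mod_cast Nat.lt_succ_iff.1 j.isLt
    linarith
  obtain ⟨c, hc, hcj⟩ := exists_distinct_sites_at_levels hL hlam hℓ 16 hz hyj
  refine ⟨c, hc, fun j => ?_⟩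
  obtain ⟨hcP, t, ht0, ht1, htL, hd⟩ := hcj j
  have hj : ((j : ℕ) : ℝ) ≤ 15 := by exact_mod_cast Nat.lt_succ_iff.1 j.isLt
  have hj0 : (0 : ℝ) ≤ ((j : ℕ) : ℝ) := Nat.cast_nonneg _
  have hw := profileWeight_pos_lt_one_near_level (ϱ := 160) (by norm_num) htL (by linarith) (by linarith) hd
  exact ⟨hcP, hw.1, hw.2, t, ht0, ht1, htL, hd⟩

/-- Record numerals of the passage: `16` levels `84, 88.4, …, 150` inside `(80 + 219/100, 160 − 219/100)`, spacing `44/10 > 2·219/100`. -/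
theorem record_passage_numerals : (84 : ℝ) + 44 / 10 * 15 = 150 ∧ (160 : ℝ) / 2 + 219 / 100 < 84 ∧ (150 : ℝ) < 160 - 219 / 100 ∧
    (2 : ℝ) * (219 / 100) < 44 / 10 := by
  refine ⟨by norm_num, by norm_num, by norm_num, by norm_num⟩

end Passage

end Summit.AtomisticToContinuum.Crystallization.Theorems.ChargedEnergyGapChartDial

end
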